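import Literature.AlgebraicGeometry.HodgeTheory.ComplexConjugationHolds
import Literature.AlgebraicGeometry.HodgeTheory.ComplexOrientationFamily
import Literature.AlgebraicGeometry.HodgeTheory.CorrespondenceCupProductIdentities
import Literature.AlgebraicGeometry.HodgeTheory.GysinFormalismPushforward
import Literature.AlgebraicGeometry.HodgeTheory.GysinKernelSplitHolds
import Literature.AlgebraicGeometry.HodgeTheory.HodgeTypeConjugation
import Literature.AlgebraicGeometry.HodgeTheory.HodgeTypePullbackVanishing
import Literature.AlgebraicGeometry.HodgeTheory.SupportedClassesIrreducibleSupports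
import Literature.AlgebraicGeometry.HodgeTheory.SupportedHodgeClassDescent
import Literature.AlgebraicTopology.SingularHomology.CupProductProofs
import Summits.HodgeConjecture.HodgeConjecture.Theses.SaitoKurokawaBridge

/-!
# Route `SaitoKurokawaBridge`: no-go lemma (A) `SupportedBridgeClassesVanish` (item stmt-HodgeConjecture-3276) — PROVED

Classes on `Y ⊗ X` dying off `pr_X⁻¹(X')` for a proper Zariski-closed `X' ⊊ X` pair to zero with
`fst*a ∪ snd*b` whenever `b` is of Hodge type `(n,0)` or `(0,n)` (`Y`, `X` smooth projective `n`-folds).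

Proof = the strategist's birth skeleton with both stubs discharged:
* `stub_gysinSpanOverProperClosed_proof` — Deligne, Hodge III Cor. 8.2.8 with Hironaka over the
  reducible closed set `pr_X⁻¹(X')` (tree: `mem_iSup_ker_restrictCompl_irreducible`,
  `exists_resolution_ker_restrictCompl_eq`, `one_le_coheight_of_mem_of_isClosed`, `pr_X` onto);
* `stub_pullbackVanishOfNotDominant_proof` — a class of type `(n,0)`/`(0,n)` on the `n`-fold `X` pulls
  back to `0` along any `r : T → X` with image in `X'` (tree: `exists_family_iUnion_range_eq`,
  `IsOfHodgeType.map_eq_zero_of_lt_left`, `Deligne1974_ker_pullback_eq_ker_pullback_resolution_holds`,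
  conjugation `IsOfHodgeType.exists_eq_conjClass` / `conjClass_map`);
* `SupportedBridgeClassesVanish_of` — the composition: `κ = Σ g_*γ`,
  `(g_*γ ∪ fst*a) ∪ snd*b = ± g_*(g^*(fst*a ∪ snd*b) ∪ γ)` (projection formula `complexGysin_cup`,
  graded commutativity) and `g^*(snd*b) = (g ≫ snd)^*b = 0`.
Main theorem: `saitoKurokawaBridge_supportedBridgeClassesVanish_proof : SupportedBridgeClassesVanish` (BY NAME).
No definition, no named-fact hypothesis, no sorry.  Provenance: the crux-strategist's workfile
`Cruxes/ExtremeBridgeFailure/SupportedBridgeClassesVanishProof.lean` (planner-authored, kernel-checked there,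
2026-08-17), landed here under the `Theorems` namespace by the prover seat as the planner requested.
-/

set_option linter.dupNamespace false

open CategoryTheory MonoidalCategory AlgebraicGeometry
open Literature.AlgebraicGeometry Literature.AlgebraicGeometry.HodgeTheory
open Literature.AlgebraicTopology.SingularHomology

namespace Summit.HodgeConjecture.HodgeConjecture.Theorems.SupportedBridgeVanish

open Summit.HodgeConjecture.HodgeConjecture.Theses.SaitoKurokawaBridge
open CartesianMonoidalCategory SemiCartesianMonoidalCategory


/-- The structure morphism of a smooth projective variety is surjective (`Spec ℂ` is one point and
the variety is non-empty, being irreducible). -/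
theorem surjective_hom_of_isSmoothProjective {n : ℕ} {Y : Motives.SchemeOver ℂ}
    (hY : Motives.IsSmoothProjective n Y) : Surjective Y.hom := by
  haveI : IrreducibleSpace Y.left :=
    haveI := hY.geometricallyIrreducible
    GeometricallyIrreducible.irreducibleSpace_of_subsingleton Y.hom
  exact ⟨fun s ↦ ⟨genericPoint Y.left, Subsingleton.elim _ _⟩⟩

/-- **Stub 1 of the skeleton of item 3276, proved.** -/
theorem stub_gysinSpanOverProperClosed_proof :
    ∀ (n : ℕ) (Y X : Motives.SchemeOver ℂ) (hY : Motives.IsSmoothProjective n Y)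
      (hX : Motives.IsSmoothProjective n X) (X' : Set X.left), IsClosed X' → X' ≠ Set.univ →
      ∀ κ : complexBetti (Y ⊗ X) (2 * n),
        complexBetti.restrictCompl (Y ⊗ X) ((snd Y X).left.base ⁻¹' X') (2 * n) κ = 0 →
        κ ∈ ⨆ (d : ℕ) (T : Motives.SchemeOver ℂ) (hT : Motives.IsSmoothProjective d T) (g : T ⟶ Y ⊗ X)
          (_ : Set.range (g ≫ snd Y X).left.base ⊆ X') (e : ℕ) (he : e + 2 * (n + n) = 2 * n + 2 * d),
          LinearMap.range (complexGysin complexOrientationFamily hT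
            (Motives.IsSmoothProjective.tensor_holds hY hX) g he) := by
  intro n Y X hY hX X' hX'c hX'u κ hκ
  have hYX := Motives.IsSmoothProjective.tensor_holds hY hX
  have hPD := hasPoincareDuality_complexOrientationFamily
  set Z : Set (Y ⊗ X).left := (snd Y X).left.base ⁻¹' X' with hZ
  have hZc : IsClosed Z := hX'c.preimage (snd Y X).left.base.hom.continuous
  -- `Z ≠ univ`: `pr_X` is onto
  have hZne : Z ≠ Set.univ := by
    intro hZu
    apply hX'u
    haveI := surjective_hom_of_isSmoothProjective hY
    have hs : Function.Surjective (snd Y X).left.base := (snd Y X).left.surjective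
    refine Set.eq_univ_of_forall fun x ↦ ?_
    obtain ⟨z, rfl⟩ := hs x
    have : z ∈ Z := by rw [hZu]; exact Set.mem_univ z
    exact this
  have hZ1 : ∀ z ∈ Z, (1 : ℕ∞) ≤ Order.coheight z := fun z hz ↦
    one_le_coheight_of_mem_of_isClosed hYX hZc hZne hz
  have hmem := mem_iSup_ker_restrictCompl_irreducible hYX hZc hZ1 hκ
  refine SetLike.le_def.mp (iSup_le fun W ↦ iSup_le fun hWc ↦ iSup_le fun hWi ↦ iSup_le fun hWZ ↦ ?_) hmem
  obtain ⟨d, T, hT, g, -, hrange, hker⟩ :=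
    exists_resolution_ker_restrictCompl_eq hYX complexOrientationFamily hPD hWc hWi
  rw [hker (2 * n)]
  refine iSup_le fun e ↦ iSup_le fun he ↦ ?_
  have hg : Set.range (g ≫ snd Y X).left.base ⊆ X' := by
    rintro _ ⟨t, rfl⟩
    have ht : g.left.base t ∈ W := hrange ▸ Set.mem_range_self t
    have hz : g.left.base t ∈ Z := hWZ ht
    simpa only [hZ, Set.mem_preimage, Over.comp_left, Scheme.Hom.comp_base, TopCat.coe_comp,
      Function.comp_apply] using hz
  exact le_iSup_of_le d (le_iSup_of_le T (le_iSup_of_le hT (le_iSup_of_le g (le_iSup_of_le hg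
    (le_iSup_of_le e (le_iSup_of_le he le_rfl))))))



/-- Type `(n,0)` case. -/
theorem map_eq_zero_of_range_subset_of_type_n0 {n d : ℕ} {X T : Motives.SchemeOver ℂ}
    (hX : Motives.IsSmoothProjective n X) {X' : Set X.left} (hX'c : IsClosed X')
    (hX'u : X' ≠ Set.univ) (_hT : Motives.IsSmoothProjective d T) (r : T ⟶ X)
    (hr : Set.range r.left.base ⊆ X') {c : complexBetti X n} (hc : IsOfHodgeType n X n n 0 c) :
    complexBetti.map r n c = 0 := by
  -- resolutions of the components of `X'`
  have hZ1 : ∀ z ∈ X', (1 : ℕ∞) ≤ Order.coheight z := fun z hz ↦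
    one_le_coheight_of_mem_of_isClosed hX hX'c hX'u hz
  obtain ⟨ι, _, m, Y, hY, g, hm, hU⟩ :=
    exists_family_iUnion_range_eq Resolution.Hironaka1964_projective_holds hX hX'c hZ1
  -- `c` dies on each `Y j` (type `(n,0)`, `dim Y j < n`)
  have hg0 : ∀ j, complexBetti.map (g j) n c = 0 := fun j ↦ by
    obtain ⟨B⟩ := nonempty_hodgeModel_holds (n := m j) (X := Y j) (hY j)
    exact hc.map_eq_zero_of_lt_left (hY j) hX B (g j) (hm j)
  -- Deligne: `c` dies on an open `V ⊇ X'(ℂ)`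
  obtain ⟨V, -, hsub, hV⟩ :=
    Deligne1974_ker_pullback_eq_ker_pullback_resolution_holds hX hY g n c hg0
  -- `r(ℂ)` lands in `V`
  have hland : ∀ P : Motives.ComplexPoints T, Motives.AlgPoints.mapContinuous (L := ℂ) r P ∈ V := by
    intro P
    apply hsub
    show (Motives.AlgPoints.map r P).pt ∈ ⋃ j, Set.range (g j).left.base
    rw [hU, Motives.AlgPoints.pt_map]
    exact hr ⟨P.pt, rfl⟩
  let r' : C(Motives.ComplexPoints T, V) :=
    ⟨fun P ↦ ⟨_, hland P⟩, (Motives.AlgPoints.mapContinuous (L := ℂ) r).continuous.subtype_mk _⟩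
  have hfac : Motives.AlgPoints.mapContinuous (L := ℂ) r = (subsetIncl V).comp r' := rfl
  change singularCohomology.map ℂ ℂ (Motives.AlgPoints.mapContinuous (L := ℂ) r) n c = 0
  rw [hfac, singularCohomology.map_comp, ModuleCat.comp_apply, hV, map_zero]

/-- **Stub 2 of the skeleton of item 3276, proved** (both extreme types). -/
theorem stub_pullbackVanishOfNotDominant_proof :
    ∀ (n : ℕ) (X : Motives.SchemeOver ℂ) (_ : Motives.IsSmoothProjective n X) (X' : Set X.left),
      IsClosed X' → X' ≠ Set.univ →
      ∀ (d : ℕ) (T : Motives.SchemeOver ℂ) (_ : Motives.IsSmoothProjective d T) (r : T ⟶ X),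
        Set.range r.left.base ⊆ X' →
        ∀ b : complexBetti X n, (IsOfHodgeType n X n n 0 b ∨ IsOfHodgeType n X n 0 n b) →
          complexBetti.map r n b = 0 := by
  intro n X hX X' hX'c hX'u d T hT r hr b hb
  rcases hb with hb | hb
  · exact map_eq_zero_of_range_subset_of_type_n0 hX hX'c hX'u hT r hr hb
  · obtain ⟨c, hc, rfl⟩ := hb.exists_eq_conjClass hX
    change singularCohomology.map ℂ ℂ (Motives.AlgPoints.mapContinuous (L := ℂ) r) n
      (HodgeTheory.conjClass (Motives.ComplexPoints X) n c) = 0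
    rw [← conjClass_map]
    have h0 := map_eq_zero_of_range_subset_of_type_n0 hX hX'c hX'u hT r hr hc
    change singularCohomology.map ℂ ℂ (Motives.AlgPoints.mapContinuous (L := ℂ) r) n c = 0 at h0
    rw [h0, conjClass_zero]


/-- COMPOSITION (kernel-checked, no sorry of its own): the two stubs give item 3276 BY NAME. -/
theorem SupportedBridgeClassesVanish_of
    (h1 : ∀ (n : ℕ) (Y X : Motives.SchemeOver ℂ) (hY : Motives.IsSmoothProjective n Y)
      (hX : Motives.IsSmoothProjective n X) (X' : Set X.left), IsClosed X' → X' ≠ Set.univ →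
      ∀ κ : complexBetti (Y ⊗ X) (2 * n),
        complexBetti.restrictCompl (Y ⊗ X) ((snd Y X).left.base ⁻¹' X') (2 * n) κ = 0 →
        κ ∈ ⨆ (d : ℕ) (T : Motives.SchemeOver ℂ) (hT : Motives.IsSmoothProjective d T) (g : T ⟶ Y ⊗ X)
          (_ : Set.range (g ≫ snd Y X).left.base ⊆ X') (e : ℕ) (he : e + 2 * (n + n) = 2 * n + 2 * d),
          LinearMap.range (complexGysin complexOrientationFamily hT
            (Motives.IsSmoothProjective.tensor_holds hY hX) g he))
    (h2 : ∀ (n : ℕ) (X : Motives.SchemeOver ℂ) (_ : Motives.IsSmoothProjective n X) (X' : Set X.left),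
      IsClosed X' → X' ≠ Set.univ →
      ∀ (d : ℕ) (T : Motives.SchemeOver ℂ) (_ : Motives.IsSmoothProjective d T) (r : T ⟶ X),
        Set.range r.left.base ⊆ X' →
        ∀ b : complexBetti X n, (IsOfHodgeType n X n n 0 b ∨ IsOfHodgeType n X n 0 n b) →
          complexBetti.map r n b = 0) :
    SupportedBridgeClassesVanish := by
  intro n Y X hY hX X' hX'c hX'u κ hκ a b hb
  have hYX := Motives.IsSmoothProjective.tensor_holds hY hX
  let L : complexBetti (Y ⊗ X) (2 * n) →ₗ[ℂ] complexBetti (Y ⊗ X) (2 * n + n + n) :=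
    ((cupProduct (rfl : 2 * n + n + n = 2 * n + n + n)).flip (complexBetti.map (snd Y X) n b)) ∘ₗ
      ((cupProduct (rfl : 2 * n + n = 2 * n + n)).flip (complexBetti.map (fst Y X) n a))
  have hL : ∀ κ, L κ = cupProduct (rfl : 2 * n + n + n = 2 * n + n + n)
      (cupProduct (rfl : 2 * n + n = 2 * n + n) κ (complexBetti.map (fst Y X) n a))
      (complexBetti.map (snd Y X) n b) := fun κ ↦ rfl
  suffices hle : (⨆ (d : ℕ) (T : Motives.SchemeOver ℂ) (hT : Motives.IsSmoothProjective d T)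
      (g : T ⟶ Y ⊗ X) (_ : Set.range (g ≫ snd Y X).left.base ⊆ X') (e : ℕ)
      (he : e + 2 * (n + n) = 2 * n + 2 * d),
      LinearMap.range (complexGysin complexOrientationFamily hT hYX g he)) ≤ LinearMap.ker L by
    have := hle (h1 n Y X hY hX X' hX'c hX'u κ hκ)
    rwa [LinearMap.mem_ker, hL] at this
  refine iSup_le fun d ↦ iSup_le fun T ↦ iSup_le fun hT ↦ iSup_le fun g ↦ iSup_le fun hg ↦
    iSup_le fun e ↦ iSup_le fun he ↦ ?_
  rintro κ ⟨γ, rfl⟩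
  rw [LinearMap.mem_ker, hL]
  -- the second-factor pull-back dies
  have hb0 : complexBetti.map (g ≫ snd Y X) n b = 0 := h2 n X hX X' hX'c hX'u d T hT _ hg b hb
  have hgx : complexBetti.map g (n + n) (cupProduct (rfl : n + n = n + n)
      (complexBetti.map (fst Y X) n a) (complexBetti.map (snd Y X) n b)) = 0 := by
    rw [complexBetti.map_cupProduct, ← complexBetti.map_comp_apply', ← complexBetti.map_comp_apply',
      hb0, map_zero]
  -- reassociate, flip, projection formula
  rw [cupProduct_assoc (rfl : 2 * n + n = 2 * n + n) (rfl : n + n = n + n) rfl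
      (show 2 * n + (n + n) = 2 * n + n + n by omega),
    cupProduct_gradedComm_holds ℂ _ (show 2 * n + (n + n) = 2 * n + n + n by omega)
      (show (n + n) + 2 * n = 2 * n + n + n by omega),
    ← complexGysin_cup hasPoincareDuality_complexOrientationFamily hT hYX g
      (hpq := (rfl : (n + n) + e = n + n + e))
      (hab := (show (n + n + e) + 2 * (n + n) = (2 * n + n + n) + 2 * d by omega))
      (hq := he) (hpq' := (show (n + n) + 2 * n = 2 * n + n + n by omega)),
    hgx, LinearMap.map_zero₂, map_zero, smul_zero]


end Summit.HodgeConjecture.HodgeConjecture.Theorems.SupportedBridgeVanish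

namespace Summit.HodgeConjecture.HodgeConjecture.Theorems

open Summit.HodgeConjecture.HodgeConjecture.Theses.SaitoKurokawaBridge

/-- **Item stmt-HodgeConjecture-3276 (`SupportedBridgeClassesVanish`, route `SaitoKurokawaBridge`) BY NAME**:
no-go lemma (A) — classes on `Y ⊗ X` supported over `Y × X'`, `X' ⊊ X` Zariski-closed, pair to zero with
`fst*a ∪ snd*b` for `b` of type `(n,0)` or `(0,n)`.  The type is literally the route decl
`Summit.HodgeConjecture.HodgeConjecture.Theses.SaitoKurokawaBridge.SupportedBridgeClassesVanish`.
[cite: DeligneHodgeIII1974, Cor. 8.2.8] [cite: VoisinHodgeII2003, Prop. 10.24] [cite: Hironaka1964, Main Theorem I] -/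
theorem saitoKurokawaBridge_supportedBridgeClassesVanish_proof : SupportedBridgeClassesVanish :=
  SupportedBridgeVanish.SupportedBridgeClassesVanish_of
    SupportedBridgeVanish.stub_gysinSpanOverProperClosed_proof
    SupportedBridgeVanish.stub_pullbackVanishOfNotDominant_proof

end Summit.HodgeConjecture.HodgeConjecture.Theorems
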